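import Summits.MatrixMultiplication.OmegaCensus.DihedralLawModOneZ5Z5Orders
import HarnessLib

/-!
# Instances of the `ℤ₅²`-quotient law exclusions: `ℤ₁₀²`, `ℤ₅ × ℤ₂₀` (100), `ℤ₅ × ℤ₈₀`, `ℤ₁₀ × ℤ₄₀` (400), `ℤ₅ × ℤ₁₁₀` (550), `ℤ₅ × ℤ₁₅₅` (775)

ω-census `pub-omega`, family (b3), seat pub-omega-group gen 38.  Framing: lottery ticket; floor = certified bounds/negative ranges.
VALUE: named kernel instances of `no_mod_one_law_card_N_of_onto_z5z5` (`DihedralLawModOneZ5Z5Orders.lean`) for the census lines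
`|A| = 100, 400, 550, 775`: no dihedral-like group over these abelian groups (any `c₀`) has a TPP triple with `3|S||T||U| + 8 = 8|A|`;
NOT progress on ω.
-/

namespace Summit.MatrixMultiplication.OmegaCensus

open Literature.Combinatorics.Additive Finset

section Instances

variable {G : Type} [Group G] [DecidableEq G] {S T U : Finset G}

/-- Every element of `ℤ₁₀ × ℤ₁₀` has order `≤ 10 < |A|/2`. [folklore] -/
theorem two_mul_addOrderOf_lt_z10_z10 (g : ZMod 10 × ZMod 10) : 2 * addOrderOf g < Fintype.card (ZMod 10 × ZMod 10) := by
  have h1 : addOrderOf g.1 ∣ 10 := (addOrderOf_dvd_card (x := g.1)).trans (by rw [ZMod.card])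
  have h2 : addOrderOf g.2 ∣ 10 := (addOrderOf_dvd_card (x := g.2)).trans (by rw [ZMod.card])
  have hle : addOrderOf g ≤ 10 := Nat.le_of_dvd (by norm_num) (by rw [Prod.addOrderOf]; exact Nat.lcm_dvd h1 h2)
  have hA : Fintype.card (ZMod 10 × ZMod 10) = 100 := by simp [Fintype.card_prod, ZMod.card]
  omega

/-- **`ℤ₁₀ × ℤ₁₀` (`|A| = 100`): no dihedral-like group over it (any `c₀`) has a TPP triple attaining `3|S||T||U| + 8 = 8|A|`.** [folklore] -/
theorem no_mod_one_law_z10_z10 {ρ τ : ZMod 10 × ZMod 10 → G} {c₀ : ZMod 10 × ZMod 10}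
    (hρρ : ∀ a b, ρ a * ρ b = ρ (a + b)) (hρτ : ∀ a b, ρ a * τ b = τ (b - a))
    (hτρ : ∀ a b, τ a * ρ b = τ (a + b)) (hττ : ∀ a b, τ a * τ b = ρ (c₀ + b - a))
    (hρ : Function.Injective ρ) (hτ : Function.Injective τ) (hne : ∀ a b, ρ a ≠ τ b)
    (hsurj : ∀ g, (∃ a, ρ a = g) ∨ (∃ a, τ a = g)) (h : TripleProductProperty S T U) :
    3 * (S.card * T.card * U.card) + 8 ≠ 8 * Fintype.card (ZMod 10 × ZMod 10) := by
  refine no_mod_one_law_card_100_of_onto_z5z5 (by simp [Fintype.card_prod, ZMod.card]) two_mul_addOrderOf_lt_z10_z10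
    hρρ hρτ hτρ hττ hρ hτ hne hsurj
    ((ZMod.castHom (show 5 ∣ 10 by norm_num) (ZMod 5)).toAddMonoidHom.prodMap (ZMod.castHom (show 5 ∣ 10 by norm_num) (ZMod 5)).toAddMonoidHom) ?_ h
  intro q
  obtain ⟨a, ha⟩ := ZMod.castHom_surjective (show 5 ∣ 10 by norm_num) (n := 10) q.1
  obtain ⟨b, hb⟩ := ZMod.castHom_surjective (show 5 ∣ 10 by norm_num) (n := 10) q.2
  exact ⟨(a, b), Prod.ext ha hb⟩

/-- Every element of `ℤ₅ × ℤ₂₀` has order `≤ 20 < |A|/2`. [folklore] -/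
theorem two_mul_addOrderOf_lt_z5_z20 (g : ZMod 5 × ZMod 20) : 2 * addOrderOf g < Fintype.card (ZMod 5 × ZMod 20) := by
  have h1 : addOrderOf g.1 ∣ 20 := (addOrderOf_dvd_card (x := g.1)).trans (by rw [ZMod.card]; norm_num)
  have h2 : addOrderOf g.2 ∣ 20 := (addOrderOf_dvd_card (x := g.2)).trans (by rw [ZMod.card])
  have hle : addOrderOf g ≤ 20 := Nat.le_of_dvd (by norm_num) (by rw [Prod.addOrderOf]; exact Nat.lcm_dvd h1 h2)
  have hA : Fintype.card (ZMod 5 × ZMod 20) = 100 := by simp [Fintype.card_prod, ZMod.card]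
  omega

/-- **`ℤ₅ × ℤ₂₀` (`|A| = 100`): no dihedral-like group over it (any `c₀`) has a TPP triple attaining `3|S||T||U| + 8 = 8|A|`.** [folklore] -/
theorem no_mod_one_law_z5_z20 {ρ τ : ZMod 5 × ZMod 20 → G} {c₀ : ZMod 5 × ZMod 20}
    (hρρ : ∀ a b, ρ a * ρ b = ρ (a + b)) (hρτ : ∀ a b, ρ a * τ b = τ (b - a))
    (hτρ : ∀ a b, τ a * ρ b = τ (a + b)) (hττ : ∀ a b, τ a * τ b = ρ (c₀ + b - a))
    (hρ : Function.Injective ρ) (hτ : Function.Injective τ) (hne : ∀ a b, ρ a ≠ τ b)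
    (hsurj : ∀ g, (∃ a, ρ a = g) ∨ (∃ a, τ a = g)) (h : TripleProductProperty S T U) :
    3 * (S.card * T.card * U.card) + 8 ≠ 8 * Fintype.card (ZMod 5 × ZMod 20) := by
  refine no_mod_one_law_card_100_of_onto_z5z5 (by simp [Fintype.card_prod, ZMod.card]) two_mul_addOrderOf_lt_z5_z20
    hρρ hρτ hτρ hττ hρ hτ hne hsurj
    ((AddMonoidHom.id (ZMod 5)).prodMap (ZMod.castHom (show 5 ∣ 20 by norm_num) (ZMod 5)).toAddMonoidHom) ?_ h
  intro q
  obtain ⟨b, hb⟩ := ZMod.castHom_surjective (show 5 ∣ 20 by norm_num) (n := 20) q.2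
  exact ⟨(q.1, b), Prod.ext rfl hb⟩

/-- Every element of `ℤ₅ × ℤ₈₀ (≅ ℤ₁₆ × ℤ₅²)` has order `≤ 80 < |A|/2`. [folklore] -/
theorem two_mul_addOrderOf_lt_z5_z80 (g : ZMod 5 × ZMod 80) : 2 * addOrderOf g < Fintype.card (ZMod 5 × ZMod 80) := by
  have h1 : addOrderOf g.1 ∣ 80 := (addOrderOf_dvd_card (x := g.1)).trans (by rw [ZMod.card]; norm_num)
  have h2 : addOrderOf g.2 ∣ 80 := (addOrderOf_dvd_card (x := g.2)).trans (by rw [ZMod.card])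
  have hle : addOrderOf g ≤ 80 := Nat.le_of_dvd (by norm_num) (by rw [Prod.addOrderOf]; exact Nat.lcm_dvd h1 h2)
  have hA : Fintype.card (ZMod 5 × ZMod 80) = 400 := by simp [Fintype.card_prod, ZMod.card]
  omega

/-- **`ℤ₅ × ℤ₈₀ (≅ ℤ₁₆ × ℤ₅²)` (`|A| = 400`): no dihedral-like group over it (any `c₀`) has a TPP triple attaining `3|S||T||U| + 8 = 8|A|`.** [folklore] -/
theorem no_mod_one_law_z5_z80 {ρ τ : ZMod 5 × ZMod 80 → G} {c₀ : ZMod 5 × ZMod 80}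
    (hρρ : ∀ a b, ρ a * ρ b = ρ (a + b)) (hρτ : ∀ a b, ρ a * τ b = τ (b - a))
    (hτρ : ∀ a b, τ a * ρ b = τ (a + b)) (hττ : ∀ a b, τ a * τ b = ρ (c₀ + b - a))
    (hρ : Function.Injective ρ) (hτ : Function.Injective τ) (hne : ∀ a b, ρ a ≠ τ b)
    (hsurj : ∀ g, (∃ a, ρ a = g) ∨ (∃ a, τ a = g)) (h : TripleProductProperty S T U) :
    3 * (S.card * T.card * U.card) + 8 ≠ 8 * Fintype.card (ZMod 5 × ZMod 80) := by
  refine no_mod_one_law_card_400_of_onto_z5z5 (by simp [Fintype.card_prod, ZMod.card]) two_mul_addOrderOf_lt_z5_z80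
    hρρ hρτ hτρ hττ hρ hτ hne hsurj
    ((AddMonoidHom.id (ZMod 5)).prodMap (ZMod.castHom (show 5 ∣ 80 by norm_num) (ZMod 5)).toAddMonoidHom) ?_ h
  intro q
  obtain ⟨b, hb⟩ := ZMod.castHom_surjective (show 5 ∣ 80 by norm_num) (n := 80) q.2
  exact ⟨(q.1, b), Prod.ext rfl hb⟩

/-- Every element of `ℤ₁₀ × ℤ₄₀ (≅ ℤ₂ × ℤ₈ × ℤ₅²)` has order `≤ 40 < |A|/2`. [folklore] -/
theorem two_mul_addOrderOf_lt_z10_z40 (g : ZMod 10 × ZMod 40) : 2 * addOrderOf g < Fintype.card (ZMod 10 × ZMod 40) := by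
  have h1 : addOrderOf g.1 ∣ 40 := (addOrderOf_dvd_card (x := g.1)).trans (by rw [ZMod.card]; norm_num)
  have h2 : addOrderOf g.2 ∣ 40 := (addOrderOf_dvd_card (x := g.2)).trans (by rw [ZMod.card])
  have hle : addOrderOf g ≤ 40 := Nat.le_of_dvd (by norm_num) (by rw [Prod.addOrderOf]; exact Nat.lcm_dvd h1 h2)
  have hA : Fintype.card (ZMod 10 × ZMod 40) = 400 := by simp [Fintype.card_prod, ZMod.card]
  omega

/-- **`ℤ₁₀ × ℤ₄₀ (≅ ℤ₂ × ℤ₈ × ℤ₅²)` (`|A| = 400`): no dihedral-like group over it (any `c₀`) has a TPP triple attaining `3|S||T||U| + 8 = 8|A|`.** [folklore] -/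
theorem no_mod_one_law_z10_z40 {ρ τ : ZMod 10 × ZMod 40 → G} {c₀ : ZMod 10 × ZMod 40}
    (hρρ : ∀ a b, ρ a * ρ b = ρ (a + b)) (hρτ : ∀ a b, ρ a * τ b = τ (b - a))
    (hτρ : ∀ a b, τ a * ρ b = τ (a + b)) (hττ : ∀ a b, τ a * τ b = ρ (c₀ + b - a))
    (hρ : Function.Injective ρ) (hτ : Function.Injective τ) (hne : ∀ a b, ρ a ≠ τ b)
    (hsurj : ∀ g, (∃ a, ρ a = g) ∨ (∃ a, τ a = g)) (h : TripleProductProperty S T U) :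
    3 * (S.card * T.card * U.card) + 8 ≠ 8 * Fintype.card (ZMod 10 × ZMod 40) := by
  refine no_mod_one_law_card_400_of_onto_z5z5 (by simp [Fintype.card_prod, ZMod.card]) two_mul_addOrderOf_lt_z10_z40
    hρρ hρτ hτρ hττ hρ hτ hne hsurj
    ((ZMod.castHom (show 5 ∣ 10 by norm_num) (ZMod 5)).toAddMonoidHom.prodMap (ZMod.castHom (show 5 ∣ 40 by norm_num) (ZMod 5)).toAddMonoidHom) ?_ h
  intro q
  obtain ⟨a, ha⟩ := ZMod.castHom_surjective (show 5 ∣ 10 by norm_num) (n := 10) q.1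
  obtain ⟨b, hb⟩ := ZMod.castHom_surjective (show 5 ∣ 40 by norm_num) (n := 40) q.2
  exact ⟨(a, b), Prod.ext ha hb⟩

/-- Every element of `ℤ₅ × ℤ₁₁₀ (the non-cyclic abelian group of order 550)` has order `≤ 110 < |A|/2`. [folklore] -/
theorem two_mul_addOrderOf_lt_z5_z110 (g : ZMod 5 × ZMod 110) : 2 * addOrderOf g < Fintype.card (ZMod 5 × ZMod 110) := by
  have h1 : addOrderOf g.1 ∣ 110 := (addOrderOf_dvd_card (x := g.1)).trans (by rw [ZMod.card]; norm_num)
  have h2 : addOrderOf g.2 ∣ 110 := (addOrderOf_dvd_card (x := g.2)).trans (by rw [ZMod.card])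
  have hle : addOrderOf g ≤ 110 := Nat.le_of_dvd (by norm_num) (by rw [Prod.addOrderOf]; exact Nat.lcm_dvd h1 h2)
  have hA : Fintype.card (ZMod 5 × ZMod 110) = 550 := by simp [Fintype.card_prod, ZMod.card]
  omega

/-- **`ℤ₅ × ℤ₁₁₀ (the non-cyclic abelian group of order 550)` (`|A| = 550`): no dihedral-like group over it (any `c₀`) has a TPP triple attaining `3|S||T||U| + 8 = 8|A|`.** [folklore] -/
theorem no_mod_one_law_z5_z110 {ρ τ : ZMod 5 × ZMod 110 → G} {c₀ : ZMod 5 × ZMod 110}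
    (hρρ : ∀ a b, ρ a * ρ b = ρ (a + b)) (hρτ : ∀ a b, ρ a * τ b = τ (b - a))
    (hτρ : ∀ a b, τ a * ρ b = τ (a + b)) (hττ : ∀ a b, τ a * τ b = ρ (c₀ + b - a))
    (hρ : Function.Injective ρ) (hτ : Function.Injective τ) (hne : ∀ a b, ρ a ≠ τ b)
    (hsurj : ∀ g, (∃ a, ρ a = g) ∨ (∃ a, τ a = g)) (h : TripleProductProperty S T U) :
    3 * (S.card * T.card * U.card) + 8 ≠ 8 * Fintype.card (ZMod 5 × ZMod 110) := by
  refine no_mod_one_law_card_550_of_onto_z5z5 (by simp [Fintype.card_prod, ZMod.card]) two_mul_addOrderOf_lt_z5_z110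
    hρρ hρτ hτρ hττ hρ hτ hne hsurj
    ((AddMonoidHom.id (ZMod 5)).prodMap (ZMod.castHom (show 5 ∣ 110 by norm_num) (ZMod 5)).toAddMonoidHom) ?_ h
  intro q
  obtain ⟨b, hb⟩ := ZMod.castHom_surjective (show 5 ∣ 110 by norm_num) (n := 110) q.2
  exact ⟨(q.1, b), Prod.ext rfl hb⟩

/-- Every element of `ℤ₅ × ℤ₁₅₅ (the non-cyclic abelian group of order 775)` has order `≤ 155 < |A|/2`. [folklore] -/
theorem two_mul_addOrderOf_lt_z5_z155 (g : ZMod 5 × ZMod 155) : 2 * addOrderOf g < Fintype.card (ZMod 5 × ZMod 155) := by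
  have h1 : addOrderOf g.1 ∣ 155 := (addOrderOf_dvd_card (x := g.1)).trans (by rw [ZMod.card]; norm_num)
  have h2 : addOrderOf g.2 ∣ 155 := (addOrderOf_dvd_card (x := g.2)).trans (by rw [ZMod.card])
  have hle : addOrderOf g ≤ 155 := Nat.le_of_dvd (by norm_num) (by rw [Prod.addOrderOf]; exact Nat.lcm_dvd h1 h2)
  have hA : Fintype.card (ZMod 5 × ZMod 155) = 775 := by simp [Fintype.card_prod, ZMod.card]
  omega

/-- **`ℤ₅ × ℤ₁₅₅ (the non-cyclic abelian group of order 775)` (`|A| = 775`): no dihedral-like group over it (any `c₀`) has a TPP triple attaining `3|S||T||U| + 8 = 8|A|`.** [folklore] -/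
theorem no_mod_one_law_z5_z155 {ρ τ : ZMod 5 × ZMod 155 → G} {c₀ : ZMod 5 × ZMod 155}
    (hρρ : ∀ a b, ρ a * ρ b = ρ (a + b)) (hρτ : ∀ a b, ρ a * τ b = τ (b - a))
    (hτρ : ∀ a b, τ a * ρ b = τ (a + b)) (hττ : ∀ a b, τ a * τ b = ρ (c₀ + b - a))
    (hρ : Function.Injective ρ) (hτ : Function.Injective τ) (hne : ∀ a b, ρ a ≠ τ b)
    (hsurj : ∀ g, (∃ a, ρ a = g) ∨ (∃ a, τ a = g)) (h : TripleProductProperty S T U) :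
    3 * (S.card * T.card * U.card) + 8 ≠ 8 * Fintype.card (ZMod 5 × ZMod 155) := by
  refine no_mod_one_law_card_775_of_onto_z5z5 (by simp [Fintype.card_prod, ZMod.card]) two_mul_addOrderOf_lt_z5_z155
    hρρ hρτ hτρ hττ hρ hτ hne hsurj
    ((AddMonoidHom.id (ZMod 5)).prodMap (ZMod.castHom (show 5 ∣ 155 by norm_num) (ZMod 5)).toAddMonoidHom) ?_ h
  intro q
  obtain ⟨b, hb⟩ := ZMod.castHom_surjective (show 5 ∣ 155 by norm_num) (n := 155) q.2
  exact ⟨(q.1, b), Prod.ext rfl hb⟩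

end Instances

end Summit.MatrixMultiplication.OmegaCensus
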